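import Literature.NumberTheory.GaloisRepresentations.HomDualLocalData
import Literature.NumberTheory.GaloisRepresentations.HomDualCupConnecting
import Literature.NumberTheory.GaloisRepresentations.IdeleBrauerReciprocity
import Literature.NumberTheory.GaloisRepresentations.ContinuousCupProductCompat
import Literature.NumberTheory.GaloisRepresentations.CorNaturality
import Literature.NumberTheory.GaloisCohomology.ArchimedeanInvariantMap
import HarnessLib

/-!
# (R4), native local half at a finite place: the local Tate pairing of a LOCAL READOUT against a bidual class
# is minus the Brauer invariant of `h_*(δ₁ ·)`

Topic `NumberTheory/GaloisRepresentations`; namespace `Literature.NumberTheory.GaloisRepresentations.HomDual`.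
Theorems only; no definition, no instance, no named fact, no `sorry`.  Sequel to `HomDualLocalData` (door-c6 g17:
`localReadout ρ n hM K' h = H¹(e⁻¹)(δ₀^{K'} h)`), `HomDualCupConnecting` (door-c6 g16 F7-cup
`cupProduct_dualδ₀_eq_neg : δ₀ h ∪ y = −h_*(δ₁ y)` natively), `LocalTatePairing` (`localTatePairingZMod`),
`LocalInvariantMap` / `ArchimedeanInvariantMap` (`LocalInvariants.canonical K n (Sum.inr v) = localInvariantMap K n v =
invLevel ∘ H²(muLocalIso)`), `IdeleBrauerReciprocity` (`IdeleCohomology.brauerInvariantEquiv_kummer_eq_zmodToQmodZ`), and the cup-product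
naturality `ContPairing.cupProduct_map`.

THE STATEMENT (`zmodToQmodZ_localTatePairingZMod_localReadout`).  Let `K` be a number field, `v` a finite place,
`K_v = v.adicCompletion K`, `ρ` a finite `n`-torsion discrete Galois module on `M` with its canonical presentation
`0 → N₁ → P → M → 0` (`FreePresentation.presentationComplex ρ`), `h : N₁ → K̄_vˣ` a `Γ_{K_v}`-equivariant homomorphism
(an invariant of `Hom_ℤ(N₁|_v, K̄_vˣ)`), and `κ : M^{DD} → M` an equivariant map with `Φ f = f (κ Φ)` (the inverse
of biduality, `exists_bidual_intertwining`).  Then for every `y ∈ H¹(K_v, M^{DD})`, in `ℚ/ℤ`: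

  `(1/n) · ⟨localReadout h, y⟩_v = − inv_{K_v}( h_* δ₁^{K_v}(H¹(κ) y) )`,

where `⟨·,·⟩_v = localTatePairingZMod ρ^D n v (LocalInvariants.canonical K n v)` is THE local Tate pairing
`H¹(K_v, M^D) × H¹(K_v, M^{DD}) → ℤ/n`, `δ₁^{K_v} : H¹(K_v, M) → H²(K_v, N₁)` is the connecting map of the restricted
presentation, `h_* : H²(K_v, N₁) → H²(K_v, K̄_vˣ)`, and `inv_{K_v} = brauerInvariantEquiv K_v : H²(K_v, K̄_vˣ) ≅ ℚ/ℤ`.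
PROOF: `canonical (inr v) = invLevel ∘ H²(muLocalIso)` and `inv_{K_v} ∘ H²(kummerι) = (1/n)·invLevel` turn the
left side into `inv_{K_v}(H²(γ)(e⁻¹δ₀h ∪ y))` for `γ = kummerι ∘ muLocalIso : μₙ(K̄)|_v → K̄_vˣ`; the morphism of
pairings `(e, κ, γ)` from `M^D × M^{DD} → μₙ` to the evaluation pairing `Hom(M, K̄_vˣ) × M → K̄_vˣ`
(`(e f)(κ Φ) = ι_v(f(κ Φ)) = ι_v(Φ f)`) gives `H²(γ)(e⁻¹δ₀h ∪ y) = δ₀h ∪ H¹(κ)y` (`cupProduct_map`), and F7-cup finishes.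
This is the NATIVE-LOCAL half of hypothesis (R4) of `middleExact_allPlaces_of_readout` (presentation road to Milne
ADT I Thm. 4.10, crux `stmt-BirchSwinnertonDyer-19295`): the idèle/E-side computes `inv(ŷ ∘ ∂(f ≫ g))` as
`Σ_v inv_{K_v}(h_v,* δ₁ …)` (door-c4/door-c5, F7-dict), and this file converts each finite local term into the local
Tate pairing of the readout.  The archimedean places (`canonical (inl w) = archimedeanInvariantMap`) are NOT treated here.
HONEST FRAMING: no case of Poitou–Tate or BSD is proved here.

## References
* J. S. Milne, *Arithmetic Duality Theorems* (2nd ed. 2006), I Thm. 4.10 (proof, p. 58), I Lemma 4.13, I §1. [MilneADT2006]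
* J. Neukirch, A. Schmidt, K. Wingberg, *Cohomology of Number Fields* (2008), (1.4.2)–(1.4.4). [NeukirchSchmidtWingberg2008]
* J.-P. Serre, *Local Fields* (1979), XIII §3. [SerreLocalFields1979]
-/

noncomputable section

open CategoryTheory NumberField IsDedekindDomain
open Field (absoluteGaloisGroup)
open scoped ContRepresentation

namespace Literature.NumberTheory.GaloisRepresentations

namespace HomDual

open Literature.Algebra.Homology Literature.Algebra.Homology.DiscreteRep DiscreteGaloisModule IdeleClassBar
  FreePresentation DGMBridge Literature.NumberTheory.GaloisCohomology
  Literature.AnabelianGeometry.AbsoluteAnabelian.Prop121vii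

variable {K : Type} [Field K] [NumberField K]
variable {M : Type} [AddCommGroup M] [TopologicalSpace M] [DiscreteTopology M] [Finite M]
variable (ρ : DiscreteGaloisModule K M) (n : ℕ) [NeZero n]

/-- **The morphism of pairings `(e, κ, kummerι ∘ muLocalIso)`** from `M^D|_v × M^{DD}|_v → μₙ(K̄)|_v` to the evaluation
pairing `Hom_ℤ(M|_v, K̄_vˣ) × M|_v → K̄_vˣ`: `ι_v(Φ f) = (e f)(κ Φ)` as soon as `Φ f = f (κ Φ)`.
[cite: MilneADT2006, I §0][cite: NeukirchSchmidtWingberg2008, (1.4.2)] -/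
theorem kummer_muLocalIso_tateDualPairingLocal_eq [Finite (TateDual K M n)] (hM : ∀ m : M, n • m = 0)
    (v : HeightOneSpectrum (𝓞 K)) [CharZero (v.adicCompletion K)]
    (κ : ((ρ.tateDual n).tateDual n).toContRepresentation →ⁱL ρ.toContRepresentation)
    (hκ : ∀ (Φ : TateDual K (TateDual K M n) n) (f : TateDual K M n), Φ f = f (κ Φ))
    (f : TateDual K M n) (Φ : TateDual K (TateDual K M n) n) :
    ((muLocalIso v n).hom ≫ kummerι (v.adicCompletion K) n).hom
        ((tateDualPairingLocal (ρ.tateDual n) n (Sum.inr v)).toLin f Φ) =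
      (evalPairing (ρ.restrictField (v.adicCompletion K)) (units (v.adicCompletion K))).toLin
        ((tateDualRestrictUnitsIso K (v.adicCompletion K) ρ n hM).hom.hom f)
        ((toTopRepHom (((ρ.tateDual n).tateDual n).restrictField (v.adicCompletion K))
          (ρ.restrictField (v.adicCompletion K)) (κ.restrictField (v.adicCompletion K))).hom Φ) := by
  apply unitsVal_injective (v.adicCompletion K)
  change unitsVal (v.adicCompletion K) (kummerInclAddHom (v.adicCompletion K) n
      (muTransfer K (v.adicCompletion K) n (Φ f))) =
    unitsVal (v.adicCompletion K) ((show M →ₗ[ℤ] UnitsCarrier (v.adicCompletion K) from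
      (tateDualRestrictUnitsIso K (v.adicCompletion K) ρ n hM).hom.hom f) (κ Φ))
  rw [unitsVal_kummerInclAddHom, muVal_muTransfer, unitsVal_tateDualRestrictUnitsIso_hom_apply, hκ]

/-- **(R4), native local half at a finite place.**  For a `Γ_{K_v}`-equivariant `h : N₁ → K̄_vˣ` out of the relation
module of the canonical presentation of the finite `n`-torsion module `ρ`, an inverse-of-biduality `κ : M^{DD} → M`
(`Φ f = f (κ Φ)`), and `y ∈ H¹(K_v, M^{DD})`:
`(1/n)·⟨localReadout h, y⟩_v = − inv_{K_v}(h_*(δ₁^{K_v}(H¹(κ) y)))` in `ℚ/ℤ`, where `⟨·,·⟩_v` is THE local Tate pairing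
`localTatePairingZMod ρ^D n v (LocalInvariants.canonical K n v)`, `δ₁^{K_v}` the connecting map of the restricted
presentation and `inv_{K_v} = brauerInvariantEquiv K_v`.
[cite: MilneADT2006, I Thm. 4.10 (proof, p. 58), I §1][cite: NeukirchSchmidtWingberg2008, (1.4.2)–(1.4.4)] -/
theorem zmodToQmodZ_localTatePairingZMod_localReadout [Finite (TateDual K M n)] (hM : ∀ m : M, n • m = 0)
    (v : HeightOneSpectrum (𝓞 K)) [CharZero (v.adicCompletion K)]
    (κ : ((ρ.tateDual n).tateDual n).toContRepresentation →ⁱL ρ.toContRepresentation)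
    (hκ : ∀ (Φ : TateDual K (TateDual K M n) n) (f : TateDual K M n), Φ f = f (κ Φ))
    (h : (haveI := moduleFinite_presModule₁ ρ
      (homGaloisModule ((presModule₁ ρ).restrictField (v.adicCompletion K)) (units (v.adicCompletion K))).toTopRep.ρ.invariants))
    (y : galoisCohomology (((ρ.tateDual n).tateDual n).restrictField (v.adicCompletion K)) 1) :
    zmodToQmodZ n
        (localTatePairingZMod (ρ.tateDual n) n (Sum.inr v) (LocalInvariants.canonical K n (Sum.inr v))
          (localReadout ρ n hM (v.adicCompletion K) h) y) =
      - brauerInvariantEquiv (v.adicCompletion K)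
          (haveI := moduleFinite_presModule₁ ρ
           haveI := moduleFinite_presModule₂ ρ
           cohomologyMap (toTopRepHom ((presModule₁ ρ).restrictField (v.adicCompletion K)) (units (v.adicCompletion K))
              (equivariantMap ((presModule₁ ρ).restrictField (v.adicCompletion K)) (units (v.adicCompletion K)) h)) 2
            ((isSES_restrict (presModule₁ ρ) (presModule₂ ρ) ρ (pres_isSES ρ) (K' := v.adicCompletion K)).δ₁
              (galoisCohomology.map (κ.restrictField (v.adicCompletion K)) 1 y))) := by
  haveI := moduleFinite_presModule₁ ρ
  haveI := moduleFinite_presModule₂ ρ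
  haveI : CompactSpace (absoluteGaloisGroup (Place.Completion (Sum.inr v : Place K))) :=
    absoluteGaloisGroup_compactSpace (Place.Completion (Sum.inr v : Place K))
  haveI : CompactSpace (absoluteGaloisGroup (v.adicCompletion K)) := absoluteGaloisGroup_compactSpace (v.adicCompletion K)
  -- Step 1: `canonical (inr v) = invLevel ∘ H²(muLocalIso)` and `inv_{K_v} ∘ H²(kummerι) = (1/n)·invLevel`
  rw [localTatePairingZMod_apply, LocalInvariants.canonical_inr, localInvariantMap_apply,
    ← IdeleCohomology.brauerInvariantEquiv_kummer_eq_zmodToQmodZ]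
  change brauerInvariantEquiv (v.adicCompletion K)
      (cohomologyMap (kummerι (v.adicCompletion K) n) 2 (cohomologyMap (muLocalIso v n).hom 2
        ((tateDualPairingLocal (ρ.tateDual n) n (Sum.inr v)).cupProduct
          (localReadout ρ n hM (v.adicCompletion K) h) y))) = _
  rw [← cohomologyMap_comp_apply]
  -- Step 2: morphism of pairings ⟹ `H²(γ)(e⁻¹δ₀h ∪ y) = δ₀h ∪ H¹(κ)y`
  erw [ContPairing.cupProduct_map (tateDualPairingLocal (ρ.tateDual n) n (Sum.inr v))
    (evalPairing (ρ.restrictField (v.adicCompletion K)) (units (v.adicCompletion K)))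
    (tateDualRestrictUnitsIso K (v.adicCompletion K) ρ n hM).hom
    (toTopRepHom (((ρ.tateDual n).tateDual n).restrictField (v.adicCompletion K))
      (ρ.restrictField (v.adicCompletion K)) (κ.restrictField (v.adicCompletion K)))
    ((muLocalIso v n).hom ≫ kummerι (v.adicCompletion K) n)
    (kummer_muLocalIso_tateDualPairingLocal_eq ρ n hM v κ hκ)]
  -- Step 3: `H¹(e)(localReadout h) = δ₀ h`, then F7-cup
  change brauerInvariantEquiv (v.adicCompletion K)
      ((evalPairing (ρ.restrictField (v.adicCompletion K)) (units (v.adicCompletion K))).cupProduct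
        (cohomologyMap (tateDualRestrictUnitsIso K (v.adicCompletion K) ρ n hM).hom 1
          (cohomologyMap (tateDualRestrictUnitsIso K (v.adicCompletion K) ρ n hM).inv 1
            (dualδ₀ ((presModule₁ ρ).restrictField (v.adicCompletion K))
              ((presModule₂ ρ).restrictField (v.adicCompletion K)) (ρ.restrictField (v.adicCompletion K))
              (units (v.adicCompletion K))
              (restrictIntertwining (presModule₁ ρ) (presModule₂ ρ) (presIncl ρ))
              (restrictIntertwining (presModule₂ ρ) ρ (presProj ρ))
              (isSES_restrict (presModule₁ ρ) (presModule₂ ρ) ρ (pres_isSES ρ))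
              (baer_unitsCarrier (v.adicCompletion K)) h)))
        (galoisCohomology.map (κ.restrictField (v.adicCompletion K)) 1 y)) = _
  rw [cohomologyMap_tateDualRestrictUnitsIso_hom_inv_apply, cupProduct_dualδ₀_eq_neg]
  exact map_neg (brauerInvariantEquiv (v.adicCompletion K)) _

end HomDual

end Literature.NumberTheory.GaloisRepresentations

end
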